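import Summits.BirchSwinnertonDyer.BirchSwinnertonDyer.Theorems.SchneiderFreeAdditiveX3PotMultBranchIMCReductions
import HarnessLib

/-!
# Route `SchneiderFreeAdditiveX3` (rung K1 door), crux `PotMultBranchIMC` (item stmt-BirchSwinnertonDyer-19176):
# the crux IS its pure-divisibility half, modulo the control corner

Cell `bsd-schneider-ideate`, seat `bsd-schneider-door-c2` (prover, generation 4). HONEST FRAMING: pure
logic on the route's sockets; NOTHING is asserted about elliptic curves; the crux stays OPEN; BSD is not
advanced; `--supports` material for item 19176 (the kernel form of a RE-TYPING RECOMMENDATION to the route's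
base unit, F2-class rule).

The socket `AdditiveIMCLowerBDPOnTreeLeAt` of the crux is `∃ n, HasCharValuationAt … n ∧ 2·ord_p log_ω P ≤ n + 2s`:
a TORSION conjunct (`X_ac^∅` is `Λ`-torsion with `f(0) ≠ 0`) and a DIVISIBILITY conjunct. The torsion
conjunct is exactly what the control corner proves (`AdditiveControlOnTreeAt` carries its own `∃ n'`; door-c2
g0's `stub_charTorsion_of_anticycControlAdditive`), and that proof consumes cite-only facts (Kolyvagin,
Poitou–Tate, Brink) — so the fact-free crux can never close in-tree from analytic inputs alone (F2-class, same
defect as 19178/19179/19175). The DIVISIBILITY conjunct in the shape "for every `HasCharValuationAt`-witness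
`n`" — VERBATIM the registered stub `stub_divisibilityLe` of skeleton 66f7551f… and the conclusion of the
typed-halves theorem `potMult_stub_divisibilityLe_of_typedHalves` (H1 ∧ H2 ∧ H3 on (M)) — is what the
analytic side supplies. This file checks:

* `potMult_divisibilityLe_of_potMultBranchIMC` — the crux ⟹ its pure-divisibility half, UNCONDITIONALLY
  (uniqueness of `ord_p f(0)`, `HasCharValuationAt.unique`);
* `potMultBranchIMC_iff_divisibilityLe_of_anticycControlAdditiveK` / `…KF` — modulo Kolyvagin and the
  control item (rev-6 `AnticycControlAdditiveK` = 19295, or rev-10 `AnticycControlAdditiveKF` = 19548 fed the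
  four `ControlFacts` conjuncts) the crux is EQUIVALENT to its pure-divisibility half (← is door-c2 g0's
  `potMultBranchIMC_of_anticycControlAdditive_of_divisibilityLe`).

Recommendation (planner's call, not filed here): re-type r2 as the pure-divisibility statement (a new
conjecture-grade crux with the displayed signature; `closes` feeds it and the control item to
`potMultBranchIMC_of_anticycControlAdditive_of_divisibilityLe`), 19176 → aside; its open content is then
exactly H3 on (M) plus the two derivations H1/H2 (skeleton v3, this seat).

References: Castella, Camb. J. Math. 6 (2018) Thm. 2.3 (generator-independence of `#ℤ_p/f(0)`);
Jetchev–Skinner–Wan 2017 §7.4.1.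
-/

noncomputable section

open scoped Classical

open WeierstrassCurve NumberField IsDedekindDomain Field
  Literature.NumberTheory.EllipticCurves
  Literature.NumberTheory.EllipticCurves.ModularForms
  Literature.NumberTheory.EllipticCurves.GreenbergSelmer
  Literature.NumberTheory.EllipticCurves.Rank1Residual
  Literature.NumberTheory.EllipticCurves.Rank1Residual.Typed
  Summit.BirchSwinnertonDyer.Rank1Residual
  Summit.BirchSwinnertonDyer.Rank1Residual.X11b
  Summit.BirchSwinnertonDyer.Rank1Residual.X11b.AcSelmer
  Summit.BirchSwinnertonDyer.Rank1Residual.X11b.Halves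
  Summit.BirchSwinnertonDyer.BirchSwinnertonDyer.Theses.SchneiderFreeAdditiveX3

-- D-0017 layout: summit = sub-problem, so `Summit.BirchSwinnertonDyer.BirchSwinnertonDyer.…` is the
-- mandated namespace (same option as the route's sockets files).
set_option linter.dupNamespace false
set_option autoImplicit false

namespace Summit.BirchSwinnertonDyer.BirchSwinnertonDyer.Theorems.SchneiderFree

/-- **The crux ⟹ its pure-divisibility half, unconditionally.** If `PotMultBranchIMC` holds then at every
door datum on the (M) cell, every anticyclotomic frame with `𝔭 ∣ p` of degree one and EVERY `n` with
`HasCharValuationAt … n`: `2·ord_p log_ω P ≤ n + 2·v_p(c)` (the registered stub `stub_divisibilityLe` of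
skeleton 66f7551f… verbatim). Proof: the crux's witness `m` equals `n` by generator-independence of
`ord_p f(0)` (`HasCharValuationAt.unique`). [cite: Castella2018, Thm. 2.3 (arXiv:1704.06608 p. 5)] -/
theorem potMult_divisibilityLe_of_potMultBranchIMC (h2 : PotMultBranchIMC) :
    ∀ (W : WeierstrassCurve ℚ) [W.IsElliptic] [W.IsGloballyMinimal] (p : ℕ) [Fact p.Prime],
      W.analyticRank = 1 → p ≠ 2 → ClassX3 W p → Additive.SubM W p →
      ∀ (N : ℕ) [NeZero N] (K : Type) [Field K] [NumberField K]
        (Dt : ModularParametrizationData W N) (H : HeegnerDatum N (NumberField.discr K)) (ι : K →+* ℂ)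
        (P : (W.baseChange K).toAffine.Point),
        W.analyticRank = 1 → Additive.N10.Locus W p → W.conductorNorm ℤ = N → IsImaginaryQuadratic K →
        Odd (NumberField.discr K) → ¬ p ∣ Units.torsionOrder K → SatisfiesHeegnerHypothesis N K →
        (W.quadraticTwist (NumberField.discr K : ℚ)).entireLFunction 1 ≠ 0 →
        WeierstrassCurve.Affine.Point.map ι.toRatAlgHom P = heegnerPointComplex Dt H →
        ¬ IsOfFinAddOrder P →
        ∀ (κ : ZpExtension K p), κ.IsAnticyclotomic →
          ∀ (γ : Field.absoluteGaloisGroup K) [Fact (κ.IsTopGenerator γ)]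
            (𝔭 : HeightOneSpectrum (𝓞 K)) (h𝔭 : ((p : ℕ) : 𝓞 K) ∈ 𝔭.asIdeal)
            (he : 𝔭.asIdeal.ramificationIdx (𝓞 ℚ) = 1) (hf : 𝔭.asIdeal.inertiaDeg (𝓞 ℚ) = 1),
            ∀ n : ℕ, XAc.HasCharValuationAt (W.baseChange K) p κ 𝔭 ∅ γ n →
              2 * X11b.padicLogOrd W p (embAt K p 𝔭 h𝔭 he hf) P ≤
                (n : ℤ) + 2 * (padicValNat p Dt.c.natAbs : ℤ) := by
  intro W _ _ p _ hr hp2 hX hS N _ K _ _ Dt H ι P hr' hloc hN hK hodd hunit hHe hL hP hnt κ hκ γ _ 𝔭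
    h𝔭 he hf n hn
  obtain ⟨m, hm, hle⟩ :=
    h2 W p hr hp2 hX hS N K Dt H ι P hr' hloc hN hK hodd hunit hHe hL hP hnt κ hκ γ 𝔭 h𝔭 he hf
  obtain rfl : m = n := hm.unique hn
  exact hle

/-- **Modulo Kolyvagin and the rev-6 control item `AnticycControlAdditiveK` (19295), the crux is
EQUIVALENT to its pure-divisibility half** (→ unconditional, above; ← door-c2 g0's
`potMultBranchIMC_of_anticycControlAdditive_of_divisibilityLe`: control supplies the torsion witness `n`).
CONDITIONAL on the two displayed hypotheses; nothing asserted.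
[cite: JetchevSkinnerWan2017, §7.4.1 (arXiv:1512.06894 p. 30)] [cite: Gross1991, Thm. 1.3] -/
theorem potMultBranchIMC_iff_divisibilityLe_of_anticycControlAdditiveK
    (hKo : ∀ (N : ℕ) [NeZero N] (W : WeierstrassCurve ℚ) (K : Type) [Field K] [NumberField K],
      kolyvagin N W K)
    (h4 : AnticycControlAdditiveK) :
    PotMultBranchIMC ↔
    ∀ (W : WeierstrassCurve ℚ) [W.IsElliptic] [W.IsGloballyMinimal] (p : ℕ) [Fact p.Prime],
      W.analyticRank = 1 → p ≠ 2 → ClassX3 W p → Additive.SubM W p →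
      ∀ (N : ℕ) [NeZero N] (K : Type) [Field K] [NumberField K]
        (Dt : ModularParametrizationData W N) (H : HeegnerDatum N (NumberField.discr K)) (ι : K →+* ℂ)
        (P : (W.baseChange K).toAffine.Point),
        W.analyticRank = 1 → Additive.N10.Locus W p → W.conductorNorm ℤ = N → IsImaginaryQuadratic K →
        Odd (NumberField.discr K) → ¬ p ∣ Units.torsionOrder K → SatisfiesHeegnerHypothesis N K →
        (W.quadraticTwist (NumberField.discr K : ℚ)).entireLFunction 1 ≠ 0 →
        WeierstrassCurve.Affine.Point.map ι.toRatAlgHom P = heegnerPointComplex Dt H →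
        ¬ IsOfFinAddOrder P →
        ∀ (κ : ZpExtension K p), κ.IsAnticyclotomic →
          ∀ (γ : Field.absoluteGaloisGroup K) [Fact (κ.IsTopGenerator γ)]
            (𝔭 : HeightOneSpectrum (𝓞 K)) (h𝔭 : ((p : ℕ) : 𝓞 K) ∈ 𝔭.asIdeal)
            (he : 𝔭.asIdeal.ramificationIdx (𝓞 ℚ) = 1) (hf : 𝔭.asIdeal.inertiaDeg (𝓞 ℚ) = 1),
            ∀ n : ℕ, XAc.HasCharValuationAt (W.baseChange K) p κ 𝔭 ∅ γ n →
              2 * X11b.padicLogOrd W p (embAt K p 𝔭 h𝔭 he hf) P ≤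
                (n : ℤ) + 2 * (padicValNat p Dt.c.natAbs : ℤ) :=
  ⟨potMult_divisibilityLe_of_potMultBranchIMC,
    potMultBranchIMC_of_anticycControlAdditive_of_divisibilityLe (h4 hKo)⟩

/-- **The same at route rev 10**: modulo the four `ControlFacts` conjuncts (item 19538), Kolyvagin and the
SERVED control item `AnticycControlAdditiveKF` (19548) — `h4F hPT hSha hBr hBrA` is definitionally the
rev-6 item — the crux is equivalent to its pure-divisibility half. CONDITIONAL; nothing asserted.
[cite: JetchevSkinnerWan2017, §7.4.1 (arXiv:1512.06894 p. 30)] [cite: Gross1991, Thm. 1.3] -/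
theorem potMultBranchIMC_iff_divisibilityLe_of_anticycControlAdditiveKF
    (hPT : ∀ (K : Type) [Field K] [NumberField K],
      Literature.NumberTheory.GaloisCohomology.poitouTate_selmerStructure_duality K)
    (hSha : ∀ (K : Type) [Field K] [NumberField K],
      Literature.NumberTheory.GaloisCohomology.poitouTate_sha_tateDual K)
    (hBr : ∀ (K : Type) [Field K] [NumberField K] (p : ℕ) [Fact p.Prime],
      ZpExtension.decomp_not_le_kerSubgroup_of_isAnticyclotomic K p)
    (hBrA : ∀ (K : Type) [Field K] [NumberField K] (p : ℕ) [Fact p.Prime],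
      ZpExtension.decomp_not_le_kerSubgroup_above_of_isAnticyclotomic K p)
    (hKo : ∀ (N : ℕ) [NeZero N] (W : WeierstrassCurve ℚ) (K : Type) [Field K] [NumberField K],
      kolyvagin N W K)
    (h4F : AnticycControlAdditiveKF) :
    PotMultBranchIMC ↔
    ∀ (W : WeierstrassCurve ℚ) [W.IsElliptic] [W.IsGloballyMinimal] (p : ℕ) [Fact p.Prime],
      W.analyticRank = 1 → p ≠ 2 → ClassX3 W p → Additive.SubM W p →
      ∀ (N : ℕ) [NeZero N] (K : Type) [Field K] [NumberField K]
        (Dt : ModularParametrizationData W N) (H : HeegnerDatum N (NumberField.discr K)) (ι : K →+* ℂ)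
        (P : (W.baseChange K).toAffine.Point),
        W.analyticRank = 1 → Additive.N10.Locus W p → W.conductorNorm ℤ = N → IsImaginaryQuadratic K →
        Odd (NumberField.discr K) → ¬ p ∣ Units.torsionOrder K → SatisfiesHeegnerHypothesis N K →
        (W.quadraticTwist (NumberField.discr K : ℚ)).entireLFunction 1 ≠ 0 →
        WeierstrassCurve.Affine.Point.map ι.toRatAlgHom P = heegnerPointComplex Dt H →
        ¬ IsOfFinAddOrder P →
        ∀ (κ : ZpExtension K p), κ.IsAnticyclotomic →
          ∀ (γ : Field.absoluteGaloisGroup K) [Fact (κ.IsTopGenerator γ)]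
            (𝔭 : HeightOneSpectrum (𝓞 K)) (h𝔭 : ((p : ℕ) : 𝓞 K) ∈ 𝔭.asIdeal)
            (he : 𝔭.asIdeal.ramificationIdx (𝓞 ℚ) = 1) (hf : 𝔭.asIdeal.inertiaDeg (𝓞 ℚ) = 1),
            ∀ n : ℕ, XAc.HasCharValuationAt (W.baseChange K) p κ 𝔭 ∅ γ n →
              2 * X11b.padicLogOrd W p (embAt K p 𝔭 h𝔭 he hf) P ≤
                (n : ℤ) + 2 * (padicValNat p Dt.c.natAbs : ℤ) :=
  potMultBranchIMC_iff_divisibilityLe_of_anticycControlAdditiveK hKo (h4F hPT hSha hBr hBrA)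

end Summit.BirchSwinnertonDyer.BirchSwinnertonDyer.Theorems.SchneiderFree

end
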